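import Summits.HodgeConjecture.HodgeConjecture.Theorems.PadicSemiregularLiftHodgeFermatVarietiesFiveQPrelim
import Summits.HodgeConjecture.HodgeConjecture.Theorems.PadicSemiregularLiftHodgeFermatVarietiesFiveQFourierSplit
import Summits.HodgeConjecture.HodgeConjecture.Theorems.PadicSemiregularLiftHodgeFermatVarietiesFiveQTopLevel
import Summits.HodgeConjecture.HodgeConjecture.Theorems.PadicSemiregularLiftHodgeFermatVarietiesFiveQLevelRight
import Summits.HodgeConjecture.HodgeConjecture.Theorems.PadicSemiregularLiftHodgeFermatVarietiesFiveQLevelLeft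
import HarnessLib

/-!
# Hodge sextuples of level `5q`, I: the unit part is symmetric off one fibre — line `cancel-by-any-claim-lattice`, crux `HodgeFermatVarieties` (stmt-HodgeConjecture-1334)

Second file of lead c3's level-`5q` programme (prime `q ≥ 7`): the STRUCTURE OF THE UNIT ENTRIES of a
Hodge sextuple `s` of `ℤ/5q`. Write `c(x)` for the multiplicity of `x` in `s` and `o(x) = c(x) - c(-x)` on
units. Inputs (wave-3 stubs of the line, LANDED separately and imported here):

* (I) Aoki's criterion at the top conductor `5q` (`FiveQ.stub_sum_inv_char_eq_zero_of_isHodgeMultiset`):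
  `Σ_{x ∈ s} χ(x)⁻¹ = 0` for every odd primitive `χ` mod `5q`;
* (†) the Fourier split (`FiveQ.stub_oddPart_split_of_orthogonal`): hence `o(x) = G(x mod q) + H(x mod 5)`
  on units with `G`, `H` odd (`units_oddPart_split`);
* (II)/(III) the criterion at the conductors `q` and `5` (`FiveQ.stub_twoPrime_level_right/left`).

THEOREM (`structure_units`): either `c(x) = c(-x)` for every unit `x` (the unit part of `s` is symmetric),
or there is a residue `b₁ ∈ (ℤ/q)ˣ` such that `c(x) ≥ c(-x) + 1` on the whole fibre `{x : x ≡ b₁ (q)}` and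
`c(x) = c(-x)` for the units off the fibres of `±b₁`. Proof: COUNTING. The support of `o` lies in
`{x : c(x) ≠ 0} ∪ {x : c(-x) ≠ 0}`, of size `≤ 12`. If `H ≢ 0` then every fibre of `(ℤ/5q)ˣ → (ℤ/q)ˣ`
(four elements, `≅ (ℤ/5)ˣ`) carries at least two points of the support (`two_le_card_fibre_support`), so
`2(q - 1) ≤ 12`, `q = 7`, and all six entries are units; then (II) and (III) (with `5` a generator mod `7` and
`χ(7) ≠ 1` for the odd characters mod `5`) make the fibre counts of `s` even in both directions, forcing
`G = H = 0` — contradiction. If `H ≡ 0 ≢ G` the support of `o` is the union of the fibres over the support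
of `G`, an even set (as `G` is odd) of size `≤ 3`, hence `{b₀, -b₀}`, which is the second alternative.

References: [Aoki1983] N. Aoki, Math. Ann. 266 (1983) §2 (criterion), Thm A′ (§7).
-/

set_option linter.dupNamespace false

noncomputable section

open Finset
open Literature.AlgebraicGeometry.HodgeTheory Literature.AlgebraicGeometry.HodgeTheory.FermatCharacter

namespace Summit.HodgeConjecture.HodgeConjecture.Theorems.CancelByAnyClaimLattice.FiveQ

/-! ### §1 Characters mod a prime: non-trivial means primitive; inverses -/

/-- A non-trivial Dirichlet character of prime level is primitive. [folklore] -/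
theorem isPrimitive_of_ne_one {p : ℕ} [Fact p.Prime] {χ : DirichletCharacter ℂ p} (hχ : χ ≠ 1) :
    χ.IsPrimitive := by
  rw [DirichletCharacter.isPrimitive_def]
  rcases (Nat.dvd_prime Fact.out).mp χ.conductor_dvd_level with h | h
  · exact absurd ((DirichletCharacter.eq_one_iff_conductor_eq_one (χ := χ)).mpr h) hχ
  · exact h

/-- An odd character is non-trivial. [folklore] -/
theorem ne_one_of_odd {m : ℕ} {χ : DirichletCharacter ℂ m} (hχ : χ (-1) = -1) : χ ≠ 1 := by
  rintro rfl
  have h1 : (1 : DirichletCharacter ℂ m) (-1) = 1 := by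
    rw [show (-1 : ZMod m) = ((-1 : (ZMod m)ˣ) : ZMod m) by simp, MulChar.one_apply_coe]
  rw [h1] at hχ
  norm_num at hχ

/-- The inverse character is odd when the character is. [folklore] -/
theorem inv_neg_one_of_odd {m : ℕ} {χ : DirichletCharacter ℂ m} (hχ : χ (-1) = -1) : χ⁻¹ (-1) = -1 := by
  rw [MulChar.inv_apply_eq_inv', hχ]; norm_num

/-- `(χ⁻¹ x)⁻¹ = χ x`. [folklore] -/
theorem inv_inv_apply {m : ℕ} (χ : DirichletCharacter ℂ m) (x : ZMod m) : (χ⁻¹ x)⁻¹ = χ x := by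
  rw [MulChar.inv_apply_eq_inv', inv_inv]

/-! ### §2 Multiset sums as sums over residues with multiplicities -/

/-- `Σ_{x ∈ s} f(x) = Σ_{x : ℤ/m} c(x) f(x)` with `c(x)` the multiplicity. [folklore] -/
theorem multiset_sum_eq_sum_count {m : ℕ} [NeZero m] (s : Multiset (ZMod m)) (f : ZMod m → ℂ) :
    (s.map f).sum = ∑ x : ZMod m, (Multiset.count x s : ℂ) * f x := by
  classical
  rw [Finset.sum_multiset_map_count]
  rw [← Finset.sum_subset (Finset.subset_univ s.toFinset)]
  · exact Finset.sum_congr rfl fun x _ ↦ by rw [nsmul_eq_mul]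
  · intro x _ hx
    rw [Multiset.mem_toFinset] at hx
    rw [Multiset.count_eq_zero_of_notMem hx, Nat.cast_zero, zero_mul]

/-! ### §3 The odd part of the unit multiplicities splits -/

section Level5q

/-- `5` is prime (instance form used for `ZMod (5 * q)`). [folklore] -/
instance fact_prime_five : Fact (Nat.Prime 5) := ⟨Nat.prime_five⟩

variable {q : ℕ} [Fact q.Prime]

omit [Fact q.Prime] in
/-- `5 ≠ q` for `q ≥ 7`. [folklore] -/
theorem five_ne (hq : 7 ≤ q) : (5 : ℕ) ≠ q := by omega

/-- **`o = G + H`**: for a Hodge multiset `s` of level `5q` there are odd functions `G` on `(ℤ/q)ˣ` and `H`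
on `(ℤ/5)ˣ` with `c(x) - c(-x) = G(x mod q) + H(x mod 5)` for every unit `x` ((I) + (†)).
[cite: Aoki1983, Prop. 2.2] -/
theorem units_oddPart_split : ∀ {q : ℕ} [Fact q.Prime], 7 ≤ q → ∀ {s : Multiset (ZMod (5 * q))}, IsHodgeMultiset s →
    ∃ (G : (ZMod q)ˣ → ℂ) (H : (ZMod 5)ˣ → ℂ),
      (∀ b, G (-b) = -G b) ∧ (∀ a, H (-a) = -H a) ∧
      ∀ x : (ZMod (5 * q))ˣ, (Multiset.count (x : ZMod (5 * q)) s : ℂ) - Multiset.count (-(x : ZMod (5 * q))) s =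
        G (ZMod.unitsMap (dvd_mul_left q 5) x) + H (ZMod.unitsMap (dvd_mul_right 5 q) x) := by
  intro q _ hq s hs
  classical
  refine stub_oddPart_split_of_orthogonal 5 q (coprime_of_ne (five_ne hq)) (fun x ↦ (Multiset.count x s : ℂ)) ?_
  intro χ₁ χ₂ h₁ h₂ hodd
  set χ := DirichletCharacter.changeLevel (dvd_mul_right 5 q) χ₁ *
    DirichletCharacter.changeLevel (dvd_mul_left q 5) χ₂ with hχdef
  -- apply (I) to the odd primitive character `χ⁻¹`
  have hinv : χ⁻¹ = DirichletCharacter.changeLevel (dvd_mul_right 5 q) χ₁⁻¹ *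
      DirichletCharacter.changeLevel (dvd_mul_left q 5) χ₂⁻¹ := by
    rw [hχdef, mul_inv, map_inv, map_inv]
  have hprim : (χ⁻¹).IsPrimitive := by
    rw [hinv]
    exact prodChar_isPrimitive (coprime_of_ne (five_ne hq)) (isPrimitive_of_ne_one (inv_ne_one.mpr h₁))
      (isPrimitive_of_ne_one (inv_ne_one.mpr h₂))
  have hoddinv : (χ⁻¹).Odd := inv_neg_one_of_odd hodd
  have key := stub_sum_inv_char_eq_zero_of_isHodgeMultiset (5 * q) s hs χ⁻¹ hoddinv hprim
  rw [multiset_sum_eq_sum_count] at key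
  simpa only [inv_inv_apply] using key

/-! ### §4 Fibre sums of the multiplicities -/

/-- The sum of an odd function over `(ℤ/5)ˣ` vanishes. [folklore] -/
theorem sum_units_eq_zero_of_odd {f : ℕ} [NeZero f] {H : (ZMod f)ˣ → ℂ} (hH : ∀ a, H (-a) = -H a) :
    ∑ a : (ZMod f)ˣ, H a = 0 := by
  have h : ∑ a : (ZMod f)ˣ, H a = ∑ a : (ZMod f)ˣ, H (-a) :=
    (Fintype.sum_equiv (Equiv.neg _) _ _ fun a ↦ by simp).symm
  simp only [hH, Finset.sum_neg_distrib] at h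
  linear_combination h / 2

/-- **Fibre sums of `o`**: with `n(b) = Σ_{x ≡ b (q), x unit} c(x)`,
`n(b) - n(-b) = 4 G(b)` (sum `o = G + H` over the fibre of `b`; `Σ H = 0`). [folklore] -/
theorem fibre_sum_count (hq : 7 ≤ q) {s : Multiset (ZMod (5 * q))} {G : (ZMod q)ˣ → ℂ} {H : (ZMod 5)ˣ → ℂ}
    (hH : ∀ a, H (-a) = -H a)
    (ho : ∀ x : (ZMod (5 * q))ˣ, (Multiset.count (x : ZMod (5 * q)) s : ℂ) - Multiset.count (-(x : ZMod (5 * q))) s =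
      G (ZMod.unitsMap (dvd_mul_left q 5) x) + H (ZMod.unitsMap (dvd_mul_right 5 q) x))
    (b : (ZMod q)ˣ) :
    (∑ x ∈ univ.filter (fun x : (ZMod (5 * q))ˣ ↦ ZMod.unitsMap (dvd_mul_left q 5) x = b),
        (Multiset.count (x : ZMod (5 * q)) s : ℂ)) -
      ∑ x ∈ univ.filter (fun x : (ZMod (5 * q))ˣ ↦ ZMod.unitsMap (dvd_mul_left q 5) x = -b),
        (Multiset.count (x : ZMod (5 * q)) s : ℂ) = 4 * G b := by
  classical
  have hpq : (5 : ℕ) ≠ q := five_ne hq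
  -- the second sum, reindexed by `x ↦ -x`, is the sum of `c(-x)` over the fibre of `b`
  have hneg : ∑ x ∈ univ.filter (fun x : (ZMod (5 * q))ˣ ↦ ZMod.unitsMap (dvd_mul_left q 5) x = -b),
      (Multiset.count (x : ZMod (5 * q)) s : ℂ) =
      ∑ x ∈ univ.filter (fun x : (ZMod (5 * q))ˣ ↦ ZMod.unitsMap (dvd_mul_left q 5) x = b),
        (Multiset.count (-(x : ZMod (5 * q))) s : ℂ) := by
    refine Finset.sum_nbij' (fun x ↦ -x) (fun x ↦ -x) (fun x hx ↦ ?_) (fun x hx ↦ ?_) (fun x _ ↦ neg_neg x)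
      (fun x _ ↦ neg_neg x) (fun x _ ↦ by rw [Units.val_neg, neg_neg])
    · simp only [mem_filter, mem_univ, true_and] at hx ⊢
      rw [unitsMap_neg, hx, neg_neg]
    · simp only [mem_filter, mem_univ, true_and] at hx ⊢
      rw [unitsMap_neg, hx]
  rw [hneg, ← Finset.sum_sub_distrib]
  have h1 : ∑ x ∈ univ.filter (fun x : (ZMod (5 * q))ˣ ↦ ZMod.unitsMap (dvd_mul_left q 5) x = b),
      ((Multiset.count (x : ZMod (5 * q)) s : ℂ) - Multiset.count (-(x : ZMod (5 * q))) s) =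
      ∑ x ∈ univ.filter (fun x : (ZMod (5 * q))ˣ ↦ ZMod.unitsMap (dvd_mul_left q 5) x = b),
        (G b + H (ZMod.unitsMap (dvd_mul_right 5 q) x)) := by
    refine Finset.sum_congr rfl fun x hx ↦ ?_
    simp only [mem_filter, mem_univ, true_and] at hx
    rw [ho x, hx]
  rw [h1, Finset.sum_add_distrib, Finset.sum_const, card_fibre hpq b, sum_fibre_eq_sum_units hpq b H,
    sum_units_eq_zero_of_odd hH, add_zero, nsmul_eq_mul]
  norm_num

/-! ### §5 Counting: the support of `o` -/

/-- **At least two points per fibre when `H ≢ 0`**: for `H` odd on `(ℤ/5)ˣ` and not identically zero and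
any `g`, at least two of the four numbers `g + H(a)` are non-zero. [folklore] -/
theorem two_le_card_units_five {H : (ZMod 5)ˣ → ℂ} (hH : ∀ a, H (-a) = -H a) (hH0 : ∃ a, H a ≠ 0) (g : ℂ) :
    2 ≤ #(univ.filter fun a : (ZMod 5)ˣ ↦ g + H a ≠ 0) := by
  classical
  -- the units of `ℤ/5`
  set u2 : (ZMod 5)ˣ := ZMod.unitOfCoprime 2 (by decide) with hu2
  have hall : ∀ a : (ZMod 5)ˣ, a = 1 ∨ a = u2 ∨ a = -u2 ∨ a = -1 := by decide
  have h12 : (1 : (ZMod 5)ˣ) ≠ u2 := by decide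
  have h1m2 : (1 : (ZMod 5)ˣ) ≠ -u2 := by decide
  have h1m1 : (1 : (ZMod 5)ˣ) ≠ -1 := by decide
  have h2m2 : u2 ≠ -u2 := by decide
  have h2m1 : u2 ≠ -1 := by decide
  have hm2m1 : -u2 ≠ (-1 : (ZMod 5)ˣ) := by decide
  -- a pair of distinct units in the filter gives the bound
  have pair : ∀ a b : (ZMod 5)ˣ, a ≠ b → g + H a ≠ 0 → g + H b ≠ 0 →
      2 ≤ #(univ.filter fun a : (ZMod 5)ˣ ↦ g + H a ≠ 0) := by
    intro a b hab ha hb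
    calc 2 = #({a, b} : Finset (ZMod 5)ˣ) := by rw [card_pair hab]
      _ ≤ _ := by
        refine card_le_card ?_
        intro x hx
        simp only [mem_insert, mem_singleton] at hx
        simp only [mem_filter, mem_univ, true_and]
        rcases hx with rfl | rfl <;> assumption
  have hHm1 : H (-1) = -H 1 := hH 1
  have hHm2 : H (-u2) = -H u2 := hH u2
  -- which of `H 1`, `H u2` is non-zero?
  have hcase : H 1 ≠ 0 ∨ H u2 ≠ 0 := by
    by_contra hc
    push Not at hc
    obtain ⟨a, ha⟩ := hH0
    rcases hall a with rfl | rfl | rfl | rfl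
    · exact ha hc.1
    · exact ha hc.2
    · exact ha (by rw [hHm2, hc.2, neg_zero])
    · exact ha (by rw [hHm1, hc.1, neg_zero])
  rcases hcase with h1 | h2
  · by_cases hp : g + H 1 = 0
    · -- `g = -H 1 ≠ 0`: then `g + H(-1) = 2g ≠ 0`, and one of `g ± H u2` is non-zero
      have hg : g = -H 1 := by linear_combination hp
      have hm : g + H (-1) ≠ 0 := by rw [hHm1, hg]; intro h; apply h1; linear_combination -h / 2
      by_cases hp2 : g + H u2 = 0
      · refine pair (-1) (-u2) (Ne.symm hm2m1) hm ?_
        rw [hHm2]; intro h; apply h1; rw [hg] at hp2 h; linear_combination -(hp2 + h) / 2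
      · exact pair (-1) u2 (Ne.symm h2m1) hm hp2
    · by_cases hm : g + H (-1) = 0
      · have hg : g = H 1 := by rw [hHm1] at hm; linear_combination hm
        by_cases hp2 : g + H u2 = 0
        · refine pair 1 (-u2) h1m2 hp ?_
          rw [hHm2]; intro h; apply h1; rw [hg] at hp2 h; linear_combination (hp2 + h) / 2
        · exact pair 1 u2 h12 hp hp2
      · exact pair 1 (-1) h1m1 hp hm
  · by_cases hp : g + H u2 = 0
    · have hg : g = -H u2 := by linear_combination hp
      have hm : g + H (-u2) ≠ 0 := by rw [hHm2, hg]; intro h; apply h2; linear_combination -h / 2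
      by_cases hp1 : g + H 1 = 0
      · refine pair (-u2) (-1) hm2m1 hm ?_
        rw [hHm1]; intro h; apply h2; rw [hg] at hp1 h; linear_combination -(hp1 + h) / 2
      · exact pair (-u2) 1 (Ne.symm h1m2) hm hp1
    · by_cases hm : g + H (-u2) = 0
      · have hg : g = H u2 := by rw [hHm2] at hm; linear_combination hm
        by_cases hp1 : g + H 1 = 0
        · refine pair u2 (-1) h2m1 hp ?_
          rw [hHm1]; intro h; apply h2; rw [hg] at hp1 h; linear_combination (hp1 + h) / 2
        · exact pair u2 1 (Ne.symm h12) hp hp1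
      · exact pair u2 (-u2) h2m2 hp hm

/-- **The support of `o` has at least `2(q-1)` points when `H ≢ 0`.** [folklore] -/
theorem card_support_ge (hq : 7 ≤ q) {G : (ZMod q)ˣ → ℂ} {H : (ZMod 5)ˣ → ℂ}
    (hH : ∀ a, H (-a) = -H a) (hH0 : ∃ a, H a ≠ 0) :
    2 * (q - 1) ≤ #(univ.filter fun x : (ZMod (5 * q))ˣ ↦
      G (ZMod.unitsMap (dvd_mul_left q 5) x) + H (ZMod.unitsMap (dvd_mul_right 5 q) x) ≠ 0) := by
  classical
  have hpq : (5 : ℕ) ≠ q := five_ne hq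
  rw [card_eq_sum_card_fibre]
  have hb : ∀ b : (ZMod q)ˣ, 2 ≤ #((univ.filter fun x : (ZMod (5 * q))ˣ ↦
      G (ZMod.unitsMap (dvd_mul_left q 5) x) + H (ZMod.unitsMap (dvd_mul_right 5 q) x) ≠ 0).filter
        fun x ↦ ZMod.unitsMap (dvd_mul_left q 5) x = b) := by
    intro b
    have h := card_fibre_filter hpq b (fun a : (ZMod 5)ˣ ↦ G b + H a ≠ 0)
    rw [show ((univ.filter fun x : (ZMod (5 * q))ˣ ↦
        G (ZMod.unitsMap (dvd_mul_left q 5) x) + H (ZMod.unitsMap (dvd_mul_right 5 q) x) ≠ 0).filter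
          fun x ↦ ZMod.unitsMap (dvd_mul_left q 5) x = b) =
        univ.filter fun x : (ZMod (5 * q))ˣ ↦ ZMod.unitsMap (dvd_mul_left q 5) x = b ∧
          G b + H (ZMod.unitsMap (dvd_mul_right 5 q) x) ≠ 0 by
      ext x
      simp only [mem_filter, mem_univ, true_and]
      constructor
      · rintro ⟨h1, h2⟩; exact ⟨h2, by rw [← h2]; exact h1⟩
      · rintro ⟨h1, h2⟩; exact ⟨by rw [h1]; exact h2, h1⟩, h]
    exact two_le_card_units_five hH hH0 (G b)
  calc 2 * (q - 1) = ∑ _b : (ZMod q)ˣ, 2 := by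
        rw [Finset.sum_const, Finset.card_univ, ZMod.card_units q, smul_eq_mul, mul_comm]
    _ ≤ _ := Finset.sum_le_sum fun b _ ↦ hb b

/-- **The support of `o` is contained in the unit entries and their negatives**, hence has at most
`2 · (number of unit entries)` points. [folklore] -/
theorem card_support_le {s : Multiset (ZMod (5 * q))} {G : (ZMod q)ˣ → ℂ} {H : (ZMod 5)ˣ → ℂ}
    (ho : ∀ x : (ZMod (5 * q))ˣ, (Multiset.count (x : ZMod (5 * q)) s : ℂ) - Multiset.count (-(x : ZMod (5 * q))) s =
      G (ZMod.unitsMap (dvd_mul_left q 5) x) + H (ZMod.unitsMap (dvd_mul_right 5 q) x)) :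
    #(univ.filter fun x : (ZMod (5 * q))ˣ ↦
        G (ZMod.unitsMap (dvd_mul_left q 5) x) + H (ZMod.unitsMap (dvd_mul_right 5 q) x) ≠ 0) ≤
      2 * Multiset.card (s.filter IsUnit) := by
  classical
  -- the support is contained in `T ∪ (-T)`, `T` = the units occurring in `s`
  set T : Finset (ZMod (5 * q))ˣ := univ.filter fun x ↦ (x : ZMod (5 * q)) ∈ s with hT
  have hsub : (univ.filter fun x : (ZMod (5 * q))ˣ ↦
      G (ZMod.unitsMap (dvd_mul_left q 5) x) + H (ZMod.unitsMap (dvd_mul_right 5 q) x) ≠ 0) ⊆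
      T ∪ T.image (fun x ↦ -x) := by
    intro x hx
    simp only [mem_filter, mem_univ, true_and] at hx
    rw [← ho x] at hx
    simp only [hT, mem_union, mem_filter, mem_univ, true_and, mem_image]
    by_contra hc
    push Not at hc
    have h1 : Multiset.count (x : ZMod (5 * q)) s = 0 := Multiset.count_eq_zero.mpr hc.1
    have h2 : Multiset.count (-(x : ZMod (5 * q))) s = 0 := by
      refine Multiset.count_eq_zero.mpr fun hmem ↦ ?_
      exact hc.2 (-x) (by simpa using hmem) (neg_neg x)
    rw [h1, h2] at hx
    norm_num at hx
  -- `#T ≤ #(unit entries)`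
  have hT_le : #T ≤ Multiset.card (s.filter IsUnit) := by
    have hinj : (T.image fun x : (ZMod (5 * q))ˣ ↦ (x : ZMod (5 * q))).card = #T :=
      Finset.card_image_of_injective _ Units.val_injective
    rw [← hinj]
    calc #(T.image fun x : (ZMod (5 * q))ˣ ↦ (x : ZMod (5 * q)))
        ≤ #((s.filter IsUnit).toFinset) := by
          refine card_le_card fun y hy ↦ ?_
          simp only [mem_image, hT, mem_filter, mem_univ, true_and] at hy
          obtain ⟨x, hx, rfl⟩ := hy
          rw [Multiset.mem_toFinset, Multiset.mem_filter]
          exact ⟨hx, Units.isUnit x⟩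
      _ ≤ Multiset.card (s.filter IsUnit) := Multiset.toFinset_card_le _
  calc #(univ.filter fun x : (ZMod (5 * q))ˣ ↦
        G (ZMod.unitsMap (dvd_mul_left q 5) x) + H (ZMod.unitsMap (dvd_mul_right 5 q) x) ≠ 0)
      ≤ #(T ∪ T.image (fun x ↦ -x)) := card_le_card hsub
    _ ≤ #T + #(T.image fun x ↦ -x) := card_union_le _ _
    _ ≤ #T + #T := by
        have : #(T.image fun x : (ZMod (5 * q))ˣ ↦ -x) ≤ #T := card_image_le
        omega
    _ ≤ 2 * Multiset.card (s.filter IsUnit) := by omega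

end Level5q

end Summit.HodgeConjecture.HodgeConjecture.Theorems.CancelByAnyClaimLattice.FiveQ
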